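import Mathlib
import Literature.Probability.Percolation.Percolation
import Literature.Probability.Percolation.RSW
import Literature.Probability.Percolation.PlanarDuality
import Literature.Probability.Percolation.LayerPeeling
import HarnessLib

/-!
# Columns of the diagonal percolation strip; two generic connectivity lemmas

Topic `Literature/Probability/Percolation`. Support file for `DiagonalColumnPatterns.lean`
(dictionary step (i) of the named fact `Literature.Probability.Percolation.IkhlefPonsaingFirstPassage`,
Ikhlef–Ponsaing, J. Stat. Phys. 149 (2012), arXiv:1202.5476, §2.2 (the strip geometry) and §3.1
(the transfer matrix)).

* Coordinates on `ℤ²` drawn diagonally: `colSite c j` is the `j`-th site of the column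
  `x₀ - x₁ = c`, at level `x₀ + x₁ = 2j + (c mod 2)` (`colSite_sub`, `colSite_add`); the strip
  `ipStrip m = {0 ≤ x₀ + x₁ ≤ 2m+1}` (literally the set of the named fact), its column
  `ipCol m c = {colSite c j | j ≤ m}` (`mem_ipCol_iff`), the strip truncated on the left `ipBox m a`,
  the region left of a column `ipHalf m a c` and its columns `boxCol m a c`; sites of one column are
  never adjacent (`not_adj_colSite_colSite`).
* `eqvGen_iff_of_injective` — transporting an equivalence closure along an injective encoding whose
  range supports the relation.
* `exists_lastExit_of_openConnIn` — in the peeling situation of `LayerPeeling.lean` (old region `A`,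
  frontier `F`, new layer `B` whose open edges into `A` land in `F`), an open path inside `A ∪ B`
  from `x` to a point of `A` has a last frontier point after which it stays in `A`.

## References

* Y. Ikhlef, A. K. Ponsaing, J. Stat. Phys. 149 (2012) 10–36, arXiv:1202.5476, §2.2, §3.1.
  [IkhlefPonsaing2012]
-/

namespace Literature.Probability.Percolation

open Literature.Probability.LatticeModels

/-! ### Coordinates on the diagonal strip -/

section Coordinates

/-- The `j`-th site (from the wall) of the column `x₀ - x₁ = c` of `ℤ²` drawn diagonally: the site
with `x₀ - x₁ = c` and level `x₀ + x₁ = 2j + (c mod 2)`. [cite: IkhlefPonsaing2012, §2.2] -/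
def colSite (c : ℤ) (j : ℕ) : Site 2 := ![(j : ℤ) + (c + c % 2) / 2, (j : ℤ) + (c % 2 - c) / 2]

/-- First coordinate of `colSite`. [folklore] -/
@[simp] theorem colSite_zero (c : ℤ) (j : ℕ) : colSite c j 0 = (j : ℤ) + (c + c % 2) / 2 := rfl

/-- Second coordinate of `colSite`. [folklore] -/
@[simp] theorem colSite_one (c : ℤ) (j : ℕ) : colSite c j 1 = (j : ℤ) + (c % 2 - c) / 2 := rfl

/-- `colSite c j` lies on the column `x₀ - x₁ = c`. [cite: IkhlefPonsaing2012, §2.2] -/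
theorem colSite_sub (c : ℤ) (j : ℕ) : colSite c j 0 - colSite c j 1 = c := by
  simp only [colSite_zero, colSite_one]; omega

/-- `colSite c j` has level `x₀ + x₁ = 2j + (c mod 2)`. [cite: IkhlefPonsaing2012, §2.2] -/
theorem colSite_add (c : ℤ) (j : ℕ) : colSite c j 0 + colSite c j 1 = 2 * j + c % 2 := by
  simp only [colSite_zero, colSite_one]; omega

/-- `colSite c` is injective. [folklore] -/
theorem colSite_injective (c : ℤ) : Function.Injective (colSite c) := by
  intro i j h
  have := congrFun h 0
  simp only [colSite_zero] at this
  exact_mod_cast (add_right_cancel this)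

/-- Sites of different columns differ. [folklore] -/
theorem colSite_ne_colSite_succ (c : ℤ) (i j : ℕ) : colSite c i ≠ colSite (c + 1) j := by
  intro h
  have h1 := colSite_sub c i
  rw [h, colSite_sub] at h1
  omega

/-- The diagonal strip `0 ≤ x₀ + x₁ ≤ 2m+1` of Ikhlef–Ponsaing (width `L = 2m+1` tiles), as in the
named fact `IkhlefPonsaingFirstPassage`. [cite: IkhlefPonsaing2012, §2.2] -/
def ipStrip (m : ℕ) : Set (Site 2) := {x | 0 ≤ x 0 + x 1 ∧ x 0 + x 1 ≤ ((2 * m + 1 : ℕ) : ℤ)}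

/-- The strip truncated on the left at the column `a`: `a ≤ x₀ - x₁` (the left part of a finite
piece of the strip, cf. `tendsto_ipPassage_trunc`). [cite: IkhlefPonsaing2012, §3.1] -/
def ipBox (m : ℕ) (a : ℤ) : Set (Site 2) := ipStrip m ∩ {x | a ≤ x 0 - x 1}

/-- The columns `a ≤ x₀ - x₁ ≤ c` of the strip (the region to the left of column `c` in the
truncated strip). [cite: IkhlefPonsaing2012, §3.1] -/
def ipHalf (m : ℕ) (a c : ℤ) : Set (Site 2) := ipBox m a ∩ {x | x 0 - x 1 ≤ c}

/-- The column `x₀ - x₁ = c` of the strip. [cite: IkhlefPonsaing2012, §3.1] -/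
def ipCol (m : ℕ) (c : ℤ) : Set (Site 2) := ipStrip m ∩ {x | x 0 - x 1 = c}

/-- The column `x₀ - x₁ = c` of the truncated strip (equal to `ipCol m c` when `a ≤ c`, empty
otherwise). [cite: IkhlefPonsaing2012, §3.1] -/
def boxCol (m : ℕ) (a c : ℤ) : Set (Site 2) := ipBox m a ∩ {x | x 0 - x 1 = c}

/-- Membership in the strip. [cite: IkhlefPonsaing2012, §2.2] -/
theorem mem_ipStrip {m : ℕ} {x : Site 2} :
    x ∈ ipStrip m ↔ 0 ≤ x 0 + x 1 ∧ x 0 + x 1 ≤ ((2 * m + 1 : ℕ) : ℤ) := Iff.rfl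

/-- `colSite c j` lies in the strip iff `j ≤ m`. [cite: IkhlefPonsaing2012, §2.2] -/
theorem colSite_mem_ipStrip {m : ℕ} {c : ℤ} {j : ℕ} : colSite c j ∈ ipStrip m ↔ j ≤ m := by
  rw [mem_ipStrip, colSite_add]
  push_cast
  omega

/-- `colSite c j`, `j ≤ m`, lies in the column `c` of the strip. [cite: IkhlefPonsaing2012, §3.1] -/
theorem colSite_mem_ipCol {m : ℕ} {c : ℤ} {j : ℕ} (hj : j ≤ m) : colSite c j ∈ ipCol m c :=
  ⟨colSite_mem_ipStrip.2 hj, colSite_sub c j⟩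

/-- Every site of the column `c` of the strip is a `colSite c j`, `j ≤ m`. [cite: IkhlefPonsaing2012, §3.1] -/
theorem exists_eq_colSite_of_mem_ipCol {m : ℕ} {c : ℤ} {x : Site 2} (hx : x ∈ ipCol m c) :
    ∃ j, j ≤ m ∧ x = colSite c j := by
  obtain ⟨⟨h0, h1⟩, hc⟩ := hx
  simp only [Set.mem_setOf_eq] at hc
  push_cast at h1
  refine ⟨((x 0 + x 1 - c % 2) / 2).toNat, ?_, ?_⟩
  · have : ((x 0 + x 1 - c % 2) / 2) ≤ m := by omega
    omega
  · have hnn : 0 ≤ (x 0 + x 1 - c % 2) / 2 := by omega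
    have e0 : x 0 = colSite c ((x 0 + x 1 - c % 2) / 2).toNat 0 := by
      rw [colSite_zero, Int.toNat_of_nonneg hnn]; omega
    have e1 : x 1 = colSite c ((x 0 + x 1 - c % 2) / 2).toNat 1 := by
      rw [colSite_one, Int.toNat_of_nonneg hnn]; omega
    ext i
    fin_cases i
    · exact e0
    · exact e1

/-- The column `c` of the strip is the range of `colSite c` on `j ≤ m`. [cite: IkhlefPonsaing2012, §3.1] -/
theorem mem_ipCol_iff {m : ℕ} {c : ℤ} {x : Site 2} : x ∈ ipCol m c ↔ ∃ j, j ≤ m ∧ x = colSite c j :=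
  ⟨exists_eq_colSite_of_mem_ipCol, by rintro ⟨j, hj, rfl⟩; exact colSite_mem_ipCol hj⟩

/-- For `a ≤ c` the column `c` of the truncated strip is the full strip column. [folklore] -/
theorem mem_boxCol_iff {m : ℕ} {a c : ℤ} (ha : a ≤ c) {x : Site 2} : x ∈ boxCol m a c ↔ x ∈ ipCol m c := by
  constructor
  · rintro ⟨⟨hx, -⟩, hc⟩
    exact ⟨hx, hc⟩
  · rintro ⟨hx, hc⟩
    refine ⟨⟨hx, ?_⟩, hc⟩
    simp only [Set.mem_setOf_eq] at hc ⊢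
    omega

/-- `ipHalf m a (c+1) = ipHalf m a c ∪ boxCol m a (c+1)`. [folklore] -/
theorem ipHalf_succ (m : ℕ) (a c : ℤ) : ipHalf m a (c + 1) = ipHalf m a c ∪ boxCol m a (c + 1) :=
  diagHalf_succ_eq (ipBox m a) c

/-- Two sites of one column are not adjacent in `ℤ²`. [folklore] -/
theorem not_adj_colSite_colSite (c : ℤ) (i j : ℕ) : ¬ (zdGraph 2).Adj (colSite c i) (colSite c j) := by
  intro h
  rcases zdGraph_two_adj_sub_sub h with h1 | h1 <;> rw [colSite_sub, colSite_sub] at h1 <;> omega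

end Coordinates

/-! ### Two generic lemmas: transporting an equivalence closure, and the last exit from a layer -/

section Generic

/-- Transport of equivalence closures along an injective encoding: if `R'` only relates points of
the range of `φ` and pulls back to `R`, then `EqvGen R'` on the range is `EqvGen R`. [folklore] -/
theorem eqvGen_iff_of_injective {α β : Type*} {R : α → α → Prop} {R' : β → β → Prop} (φ : α → β)
    (hφ : Function.Injective φ) (hR : ∀ a b, R' (φ a) (φ b) ↔ R a b)
    (hrange : ∀ u v, R' u v → u ∈ Set.range φ ∧ v ∈ Set.range φ) (a b : α) :
    Relation.EqvGen R' (φ a) (φ b) ↔ Relation.EqvGen R a b := by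
  constructor
  · intro h
    suffices H : ∀ u v, Relation.EqvGen R' u v →
        ((u ∈ Set.range φ ↔ v ∈ Set.range φ) ∧
          ∀ a b, φ a = u → φ b = v → Relation.EqvGen R a b) from (H _ _ h).2 a b rfl rfl
    intro u v huv
    induction huv with
    | rel u v h =>
      refine ⟨iff_of_true (hrange u v h).1 (hrange u v h).2, fun a b ha hb => ?_⟩
      subst ha
      subst hb
      exact Relation.EqvGen.rel _ _ ((hR a b).1 h)
    | refl u =>
      refine ⟨Iff.rfl, fun a b ha hb => ?_⟩
      obtain rfl : a = b := hφ (ha.trans hb.symm)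
      exact Relation.EqvGen.refl _
    | symm u v _ ih =>
      exact ⟨ih.1.symm, fun a b ha hb => Relation.EqvGen.symm _ _ (ih.2 b a hb ha)⟩
    | trans u w v _ _ ih₁ ih₂ =>
      refine ⟨ih₁.1.trans ih₂.1, fun a b ha hb => ?_⟩
      obtain ⟨c, rfl⟩ : w ∈ Set.range φ := ih₁.1.1 ⟨a, ha⟩
      exact Relation.EqvGen.trans _ _ _ (ih₁.2 a c ha rfl) (ih₂.2 c b rfl hb)
  · intro h
    induction h with
    | rel a b h => exact Relation.EqvGen.rel _ _ ((hR a b).2 h)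
    | refl a => exact Relation.EqvGen.refl _
    | symm a b _ ih => exact Relation.EqvGen.symm _ _ ih
    | trans a b c _ _ ih₁ ih₂ => exact Relation.EqvGen.trans _ _ _ ih₁ ih₂

variable {V : Type*}

/-- **Last exit from the new layer.** In the setting of `openConnIn_union_iff_eqvGen_peel` (old
region `A`, frontier `F ⊆ A`, new layer `B`, open edges from `B` into `A` land in `F`), an open path
inside `A ∪ B` from `x` to a point `w` of the old region passes a last point `f` of the frontier
(or never needed the new layer: `f = x`), after which it stays inside `A`. [folklore] -/
theorem exists_lastExit_of_openConnIn {ω : BondConfig V} {A B F : Set V}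
    (hH : ∀ u ∈ B, ∀ v ∈ A, (openGraph ω).Adj u v → v ∈ F) {x w : V} (hw : w ∈ A)
    (h : ω ∈ openConnIn (A ∪ B) x w) :
    ∃ f, (f ∈ F ∨ f = x) ∧ ω ∈ openConnIn (A ∪ B) x f ∧ ω ∈ openConnIn A f w := by
  obtain ⟨hx, hw', ⟨p⟩⟩ := h
  have H : ∀ (u v : ↥(A ∪ B)) (_ : ((openGraph ω).induce (A ∪ B)).Walk u v), (v : V) = w →
      ∃ f, (f ∈ F ∨ f = (u : V)) ∧ ω ∈ openConnIn (A ∪ B) u f ∧ ω ∈ openConnIn A f w := by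
    intro u v p
    induction p with
    | @nil u =>
      rintro rfl
      exact ⟨u, Or.inr rfl, ⟨u.2, u.2, SimpleGraph.Reachable.refl _⟩,
        ⟨hw, hw, SimpleGraph.Reachable.refl _⟩⟩
    | @cons u v w' hadj p ih =>
      rintro rfl
      have hadj' : (openGraph ω).Adj (u : V) (v : V) := by
        rw [SimpleGraph.induce_adj] at hadj; exact hadj
      obtain ⟨f, hf, h1, h2⟩ := ih rfl
      rcases hf with hfF | rfl
      · exact ⟨f, Or.inl hfF,
          PlanarDuality.openConnIn_trans (openConnIn_of_openGraph_adj u.2 v.2 hadj') h1, h2⟩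
      · have hvA : (v : V) ∈ A := h2.1
        by_cases huA : (u : V) ∈ A
        · exact ⟨u, Or.inr rfl, ⟨u.2, u.2, SimpleGraph.Reachable.refl _⟩,
            PlanarDuality.openConnIn_trans (openConnIn_of_openGraph_adj huA hvA hadj') h2⟩
        · have huB : (u : V) ∈ B := by
            rcases u.2 with h | h
            · exact absurd h huA
            · exact h
          exact ⟨v, Or.inl (hH _ huB _ hvA hadj'), openConnIn_of_openGraph_adj u.2 v.2 hadj', h2⟩
  exact H ⟨x, hx⟩ ⟨w, hw'⟩ p rfl

end Generic

end Literature.Probability.Percolation
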